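import Literature.Topology.FourManifolds.GompfFramedTwistZero
import HarnessLib

/-!
# The framed Δ-move and the framed Δ₀-move are equivalent (leaf **F** ⇔ leaf **F₀**)

`GompfFramedTwistZero.lean` proves **F₀ from F**
(`Literature.Topology.FourManifolds.gompf2010_framedTwistZero_of_framedTwist`): the framed
Δ₀-moves of R. Gompf, *More Cappell–Shaneson spheres are standard*, Algebr. Geom. Topol. 10 (2010),
§4 ¶5 (`Literature.Topology.FourManifolds.gompf2010_framedTwistZero`, for `A` with second column
`(1, -1, 0)ᵀ`) are the framed Δ-moves of §4 ¶3
(`Literature.Topology.FourManifolds.gompf2010_framedTwist`, for `A` in standard form, `A e₁ = e₃`)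
after the change of basis `C₀ = (e₂ | e₃ | e₁ - e₂)` (`gompfDeltaZeroBasis`, `Δ₀ = C₀ Δ C₀⁻¹`).
Gompf, loc. cit.: "Although any change in monodromy arising from Theorem 2.1 can be realized by left
or right multiplication by some `Δᵏ` after a suitable change of basis, it will be convenient to have
another example expressed without the basis change."

This file proves the **converse, F from F₀**
(`Literature.Topology.FourManifolds.gompf2010_framedTwist_of_framedTwistZero`), by the inverse change
of basis: if `A e₁ = e₃` then `A'' := C₀ A C₀⁻¹` has second column
`A'' e₂ = C₀ A C₀⁻¹ e₂ = C₀ A e₁ = C₀ e₃ = e₁ - e₂ = (1, -1, 0)ᵀ`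
(`Literature.Topology.FourManifolds.conj_gompfDeltaZeroBasis_secondColumn`), `det (A'' - 1) = det (A - 1)`,
`C₀⁻¹ (Δ₀ᵏ A'') C₀ = Δᵏ A`, `C₀⁻¹ (A'' Δ₀ᵏ) C₀ = A Δᵏ`, and the framing paths again agree on the nose,
`C₀⁻¹ ((C₀ γ C₀⁻¹)·τ_{Δ₀}) C₀ = γ·τ_Δ`
(`Literature.Topology.FourManifolds.inv_conj_deltaZeroLeft_conj_along_eq`,
`Literature.Topology.FourManifolds.inv_conj_deltaZeroRight_conj_along_eq`); conjugation invariance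
**Cj** (`gompf2010_conj_invariance_holds`, `GompfConjInvariance.lean`) does the rest. Hence
**F ⇔ F₀** (`Literature.Topology.FourManifolds.gompf2010_framedTwistZero_iff_framedTwist`): the two
framed instances of Theorem 2.1 in the leaf set of
`Literature.Topology.FourManifolds.nonempty_diffeomorph_sphere_four_of_isCappellShanesonSphereOf` are
one and the same proof obligation (Theorem 2.1 proper), whichever basis it is discharged in.

Everything here is proved; no named facts are introduced.

## References

* R. E. Gompf, *More Cappell–Shaneson spheres are standard*, Algebr. Geom. Topol. 10 (2010)
  1665–1681, doi:10.2140/agt.2010.10.1665 (arXiv:0908.1914): §3 ¶3 (standard form, the matrix `Δ`),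
  §4 ¶3 ("after a change of basis … linearity is preserved when we undo the change of basis"),
  §4 ¶5 (the matrix `Δ₀`; "can be realized by left or right multiplication by some `Δᵏ` after a
  suitable change of basis"). [GompfAGT2010]
-/

open scoped Manifold ContDiff Topology
open Set Function Matrix

noncomputable section

namespace Literature.Topology.FourManifolds

/-! ### The inverse change of basis -/

section BasisChange

/-- **`C₀ A C₀⁻¹` has second column `(1, -1, 0)ᵀ` when `A` is in standard form**:
`C₀ A C₀⁻¹ e₂ = C₀ A e₁ = C₀ e₃ = e₁ - e₂` (`C₀⁻¹ e₂ = e₁`, `A e₁ = e₃`). [cite: GompfAGT2010, §4 ¶5 and §3 ¶3 (the Δ₀-move is a Δ-move after a suitable change of basis)] -/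
theorem conj_gompfDeltaZeroBasis_secondColumn {A : Matrix.SpecialLinearGroup (Fin 3) ℤ}
    (hA : IsGompfStandardForm A) :
    ((gompfDeltaZeroBasis * A * gompfDeltaZeroBasis⁻¹ : Matrix.SpecialLinearGroup (Fin 3) ℤ) :
        Matrix (Fin 3) (Fin 3) ℤ) 0 1 = 1 ∧
      ((gompfDeltaZeroBasis * A * gompfDeltaZeroBasis⁻¹ : Matrix.SpecialLinearGroup (Fin 3) ℤ) :
        Matrix (Fin 3) (Fin 3) ℤ) 1 1 = -1 ∧
      ((gompfDeltaZeroBasis * A * gompfDeltaZeroBasis⁻¹ : Matrix.SpecialLinearGroup (Fin 3) ℤ) :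
        Matrix (Fin 3) (Fin 3) ℤ) 2 1 = 0 := by
  obtain ⟨h00, h10, h20⟩ := hA
  refine ⟨?_, ?_, ?_⟩ <;>
  · simp only [Matrix.SpecialLinearGroup.coe_mul, Matrix.mul_apply, Fin.sum_univ_three,
      coe_gompfDeltaZeroBasis_inv, coe_gompfDeltaZeroBasis]
    simp [h00, h10, h20]

/-- **Undoing the inverse change of basis on the row move**: `C₀⁻¹ (Δ₀ᵏ (C₀ A C₀⁻¹)) C₀ = Δᵏ A`. [cite: GompfAGT2010, §4 ¶5 (the Δ₀-move is a Δ-move after a suitable change of basis)] -/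
theorem inv_conj_gompfDeltaZero_zpow_mul_conj (A : Matrix.SpecialLinearGroup (Fin 3) ℤ) (k : ℤ) :
    gompfDeltaZeroBasis⁻¹ * (gompfDeltaZero ^ k * (gompfDeltaZeroBasis * A * gompfDeltaZeroBasis⁻¹)) *
        gompfDeltaZeroBasis⁻¹⁻¹ = gompfDelta ^ k * A := by
  rw [gompfDeltaZero_zpow_eq_conj]
  group

/-- **Undoing the inverse change of basis on the column move**: `C₀⁻¹ ((C₀ A C₀⁻¹) Δ₀ᵏ) C₀ = A Δᵏ`. [cite: GompfAGT2010, §4 ¶5 (the Δ₀-move is a Δ-move after a suitable change of basis)] -/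
theorem inv_conj_conj_mul_gompfDeltaZero_zpow (A : Matrix.SpecialLinearGroup (Fin 3) ℤ) (k : ℤ) :
    gompfDeltaZeroBasis⁻¹ * (gompfDeltaZeroBasis * A * gompfDeltaZeroBasis⁻¹ * gompfDeltaZero ^ k) *
        gompfDeltaZeroBasis⁻¹⁻¹ = A * gompfDelta ^ k := by
  rw [gompfDeltaZero_zpow_eq_conj]
  group

end BasisChange

/-! ### The framing paths agree on the nose -/

section Paths

variable (A : Matrix.SpecialLinearGroup (Fin 3) ℤ) (k : ℤ) (γ : SmoothMatrixPath (slRealMatrix A))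

/-- **Row move: the back-conjugated framing path is `γ.deltaLeft k`.** Conjugating by `C₀⁻¹` the
path "`C₀ γ C₀⁻¹` followed by the segment to `Δ₀ᵏ (C₀ A C₀⁻¹)`" gives, pointwise,
`C₀⁻¹ (t Δ₀ᵏ + (1 - t) I) C₀ · γ = (t Δᵏ + (1 - t) I) · γ`, the path of the Δ-row move. [cite: GompfAGT2010, §4 ¶3 and ¶5 (τ the linear path; linearity preserved under change of basis)] -/
theorem inv_conj_deltaZeroLeft_conj_along_eq
    (h : gompfDeltaZeroBasis⁻¹ * (gompfDeltaZero ^ k *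
        (gompfDeltaZeroBasis * A * gompfDeltaZeroBasis⁻¹)) * gompfDeltaZeroBasis⁻¹⁻¹ =
      gompfDelta ^ k * A) :
    (((γ.conj gompfDeltaZeroBasis).deltaZeroLeft k).conj gompfDeltaZeroBasis⁻¹).along h =
      γ.deltaLeft k := by
  refine SmoothMatrixPath.ext_toFun fun θ ↦ ?_
  simp only [SmoothMatrixPath.along_toFun, SmoothMatrixPath.conj_toFun,
    SmoothMatrixPath.deltaLeft_toFun, SmoothMatrixPath.deltaZeroLeft_toFun]
  rw [inv_inv, gompfDeltaZero_zpow_eq_conj, ← conj_linearPath_slRealMatrix gompfDeltaZeroBasis]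
  simp only [Matrix.mul_assoc]
  rw [slRealMatrix_inv_mul, Matrix.mul_one, ← Matrix.mul_assoc (slRealMatrix gompfDeltaZeroBasis⁻¹),
    slRealMatrix_inv_mul, Matrix.one_mul, ← Matrix.mul_assoc (slRealMatrix gompfDeltaZeroBasis⁻¹),
    slRealMatrix_inv_mul, Matrix.one_mul]

/-- **Column move: the back-conjugated framing path is `γ.deltaRight k`** (same computation, with
`C₀⁻¹ (A'' Δ₀ᵏ A''⁻¹) C₀ = A Δᵏ A⁻¹` for `A'' = C₀ A C₀⁻¹`). [cite: GompfAGT2010, §4 ¶3 and ¶5 (τ the linear path; linearity preserved under change of basis)] -/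
theorem inv_conj_deltaZeroRight_conj_along_eq
    (h : gompfDeltaZeroBasis⁻¹ * (gompfDeltaZeroBasis * A * gompfDeltaZeroBasis⁻¹ *
        gompfDeltaZero ^ k) * gompfDeltaZeroBasis⁻¹⁻¹ = A * gompfDelta ^ k) :
    (((γ.conj gompfDeltaZeroBasis).deltaZeroRight k).conj gompfDeltaZeroBasis⁻¹).along h =
      γ.deltaRight k := by
  refine SmoothMatrixPath.ext_toFun fun θ ↦ ?_
  simp only [SmoothMatrixPath.along_toFun, SmoothMatrixPath.conj_toFun,
    SmoothMatrixPath.deltaRight_toFun, SmoothMatrixPath.deltaZeroRight_toFun]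
  have key : gompfDeltaZeroBasis * A * gompfDeltaZeroBasis⁻¹ * gompfDeltaZero ^ k *
      (gompfDeltaZeroBasis * A * gompfDeltaZeroBasis⁻¹)⁻¹ =
      gompfDeltaZeroBasis * (A * gompfDelta ^ k * A⁻¹) * gompfDeltaZeroBasis⁻¹ := by
    rw [gompfDeltaZero_zpow_eq_conj]
    group
  rw [key, ← conj_linearPath_slRealMatrix gompfDeltaZeroBasis, inv_inv]
  simp only [Matrix.mul_assoc]
  rw [slRealMatrix_inv_mul, Matrix.mul_one, ← Matrix.mul_assoc (slRealMatrix gompfDeltaZeroBasis⁻¹),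
    slRealMatrix_inv_mul, Matrix.one_mul, ← Matrix.mul_assoc (slRealMatrix gompfDeltaZeroBasis⁻¹),
    slRealMatrix_inv_mul, Matrix.one_mul]

end Paths

/-! ### F from F₀, and the equivalence -/

section Reduction

/-- **The framed Δ-move from the framed Δ₀-move (F from F₀).** For `A ∈ SL(3, ℤ)` in standard form
with `det (A - 1) = 1`, every framing path `γ` and every `k ∈ ℤ`:
`X^γ_A ≅ X^{γ·τ}_{Δᵏ A}` and `X^γ_A ≅ X^{γ·τ}_{A Δᵏ}` — by conjugation invariance (**Cj**) to
`A'' = C₀ A C₀⁻¹`, whose second column is `(1, -1, 0)ᵀ`, the framed Δ₀-move **F₀** there,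
conjugation invariance back, and the identity of framing paths
`C₀⁻¹ ((C₀ γ C₀⁻¹)·τ_{Δ₀}) C₀ = γ·τ_Δ` (Gompf 2010, §4 ¶5: the Δ₀-move is the Δ-move "after a
suitable change of basis"). [cite: GompfAGT2010, §4 ¶3 (X^{τ·σ}_B = X^σ_A for B = Δᵏ A or A Δᵏ) and §4 ¶5] -/
theorem gompf2010_framedTwist_of_framedTwistZero (hF₀ : gompf2010_framedTwistZero) :
    gompf2010_framedTwist := by
  intro A hA hdet γ k
  obtain ⟨h01, h11, h21⟩ := conj_gompfDeltaZeroBasis_secondColumn hA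
  have hdet' : (((gompfDeltaZeroBasis * A * gompfDeltaZeroBasis⁻¹ :
      Matrix.SpecialLinearGroup (Fin 3) ℤ) : Matrix (Fin 3) (Fin 3) ℤ) - 1).det = 1 := by
    rw [det_coe_conj_sub_one]
    exact hdet
  -- Cj: `X^γ_A ≅ X^{C₀ γ C₀⁻¹}_{A''}`
  obtain ⟨e₁⟩ := gompf2010_conj_invariance_holds A gompfDeltaZeroBasis γ
  -- F₀ at `A''`
  have hF' := hF₀ _ h01 h11 h21 hdet' (γ.conj gompfDeltaZeroBasis) k
  refine ⟨?_, ?_⟩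
  · obtain ⟨e₃⟩ := gompf2010_conj_invariance_holds _ gompfDeltaZeroBasis⁻¹
      ((γ.conj gompfDeltaZeroBasis).deltaZeroLeft k)
    exact nonempty_diffeomorph_trans ⟨e₁.symm⟩ (nonempty_diffeomorph_trans hF'.1
      (nonempty_diffeomorph_trans ⟨e₃.symm⟩ (nonempty_diffeomorph_trans
        (nonempty_diffeomorph_gompfSphere_along _ (inv_conj_gompfDeltaZero_zpow_mul_conj A k))
        (nonempty_diffeomorph_gompfSphere_of_eq (inv_conj_deltaZeroLeft_conj_along_eq A k γ _)))))
  · obtain ⟨e₃⟩ := gompf2010_conj_invariance_holds _ gompfDeltaZeroBasis⁻¹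
      ((γ.conj gompfDeltaZeroBasis).deltaZeroRight k)
    exact nonempty_diffeomorph_trans ⟨e₁.symm⟩ (nonempty_diffeomorph_trans hF'.2
      (nonempty_diffeomorph_trans ⟨e₃.symm⟩ (nonempty_diffeomorph_trans
        (nonempty_diffeomorph_gompfSphere_along _ (inv_conj_conj_mul_gompfDeltaZero_zpow A k))
        (nonempty_diffeomorph_gompfSphere_of_eq (inv_conj_deltaZeroRight_conj_along_eq A k γ _)))))

/-- **F ⇔ F₀**: the framed Δ-moves (§4 ¶3) and the framed Δ₀-moves (§4 ¶5) of Gompf's Theorem 2.1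
are equivalent statements on the tree's concrete spheres — one proof obligation in two bases. [cite: GompfAGT2010, §4 ¶5 (the Δ₀-move is a Δ-move after a suitable change of basis)] -/
theorem gompf2010_framedTwistZero_iff_framedTwist :
    gompf2010_framedTwistZero ↔ gompf2010_framedTwist :=
  ⟨gompf2010_framedTwist_of_framedTwistZero, gompf2010_framedTwistZero_of_framedTwist⟩

end Reduction

end Literature.Topology.FourManifolds
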